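import Literature.MeasureTheory.Group.CoveringWeightsPushforward
import Literature.NumberTheory.Automorphic.UnitaryGroupTorusSiegelCoordinates
import Literature.NumberTheory.Automorphic.UnitaryGroupTorusThreeRay
import Literature.NumberTheory.Automorphic.UnitaryGroupTorusCoveringWeights
import Literature.NumberTheory.Automorphic.UnitaryGroupAdelicOneTorus
import Literature.NumberTheory.Automorphic.IdeleClassIntegration
import Mathlib.Topology.Algebra.Group.OpenMapping
import HarnessLib

/-!
# Torus-to-idele unfolding for `U(J₃)`: `∫_{T(F)∖T(𝔸_F)} G(d₀ t) dt = C · ∫_{E^×∖𝕀_E} G(x) dx`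
(Rogawski, *Automorphic Representations of Unitary Groups in Three Variables* (1990), §7.2 p. 94 («`α₃` defines an
isomorphism of `MS∖M` with `NE^*∖NI_E`»), §7.3 p. 97 («`|α₃(m)| = ‖α₁(m)‖` … `= m(ZS′∖S′) ∫_{E^*∖I_E} […] ‖a‖ d^*a`»,
`S′ = ker α₁ = Z`): the passage from the torus integral of the fine `𝔬`-expansion to an idele-class integral;
Folland (1995), §2.6 Thm. 2.49 for the underlying Weil formula)

Topic `NumberTheory/Automorphic`; namespace `Literature.NumberTheory.Automorphic.UnitaryGroup`. THEOREMS ONLY over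
accepted tree modules: no definition, no named fact, no instance, no notation, no `sorry`. Row (C-torus) FILE 2∕3 of the
T1-qs LAW 5 road of `Cruxes/H413/Lines/F0_T1InnerFormTraceIdentity.lean` (cell `pub/hodgecm-mathlib`, crux H413): the
INSTANCE of the generic unfolding ★ `CoveringWeightsPushforward` (`exists_lintegral_comp_mul_weight_eq_mul_lintegral`:
`∫_{Γ∖G} g ∘ α = C ∫_{Λ∖Q} g` for `α : G ↠ Q` abelian, open, with finite fibre covolume) at the FIRST DIAGONAL COORDINATE

  `d₀ : T(𝔸_F) →* 𝕀_E`, `t = diag(d₀, d₁, d₂) ↦ d₀` (`T(𝔸_F) = torusInBorel F E c 3`, ★ `diagUnit`, ★ `diagUnit_torus_mul`),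

written inline as `MonoidHom.mk' (fun t => diagUnit t.2 0) …` (no definition is introduced). LETTERS: the rational torus
`Γ_T = (rationalBorel F E c 3).subgroupOf (torusInBorel F E c 3)` and its covering weights `w` (★ `UnitaryGroupTorusCoveringWeights`,
the currency of (L2-dT) and of the `T(F)∖T(𝔸_F)`-integrals of the LAW road); the principal ideles `principalIdeles E ≤ 𝕀_E`
and their covering weights `wE`, or a strict fundamental domain (`IsIdeleClassDomain`, ★ `IdeleClassIntegration`).

* §1 THE PROJECTION: `d₀` is continuous (★ `continuous_diagUnit_torus`), surjective (★ `exists_torus_diagUnit_eq`: `diag(a, 1, (c a)⁻¹)`),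
  OPEN (Mathlib's open mapping theorem `MonoidHom.isOpenMap_of_sigmaCompact`), and maps the rational torus ONTO the principal
  ideles: **`map_rationalTorusInBorel_diagUnitZero_eq_principalIdeles`** (`Γ_T ↦ Eˣ`; ★ `exists_rational_torus` for `⊇`).
* §2 THE FIBRE `ker d₀ = {diag(1, b, 1) : c(b) b = 1} ≅ U(1)_{E/F}(𝔸_F)` HAS FINITE COVOLUME MODULO ITS LATTICE:
  **`exists_isCoveringWeight_ker_diagUnitZero`** — for every Haar measure `μS` on `ker d₀` there is a `(Γ_T ⊓ ker d₀)`-covering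
  weight `wS` with `∫ wS dμS < ∞` (Godement compactness of `E¹∖U(1)(𝔸_F)` in the cover form ★ `exists_isCompact_adelicOne_cover`,
  the coordinate compacta ★ `isCompact_setOf_diagUnit_mem`, domination ★ `lintegral_mul_le_inv_mul_setLIntegral_of_le_coveringSum_indicator`);
  `discreteTopology_rationalTorusInBorel` (★ `isDiscreteRational_quasiSplit`).
* §3 THE ROW **`exists_lintegral_comp_diagUnitZero_mul_weight_eq`**: for `[E : F] = 2`, `c² = 1`, `c ≠ 1`, Haar measures `μT`
  on `T(𝔸_F)` and `μE` on `𝕀_E`: `∃ C ∈ (0, ∞)`, for every `Γ_T`-covering weight `w`, every `principalIdeles E`-covering weight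
  `wE` and every Borel `Eˣ`-invariant `G : 𝕀_E → [0,∞]`, **`∫⁻ G(d₀ t) w(t) dμT = C · ∫⁻ G(x) wE(x) dμE`**; and
  **`exists_lintegral_comp_diagUnitZero_mul_weight_eq_setLIntegral`** — the same against an idele class domain `𝓕`
  (`IsIdeleClassDomain E 𝓕`): `… = C · ∫⁻_{𝓕} G dμE`. Constants are NOT identified (LAW style `∃ C`).

The companion instance `α₁ = d₀ d₁⁻¹` (kernel the centre `Z(𝔸_F)`, Rogawski's `S′`) and the norm step `α₃ = N_{E/F} ∘ d₀`
(FILE 3) are not in this file.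

## References

* J. D. Rogawski, *Automorphic Representations of Unitary Groups in Three Variables*, Ann. of Math. Stud. 123 (1990), §1.10,
  §7.2 (p. 94), §7.3 (p. 97) [Rogawski1990].
* G. B. Folland, *A Course in Abstract Harmonic Analysis* (1995), §2.6 Thm. 2.49 [Folland1995].
* R. Godement, *Domaines fondamentaux des groupes arithmétiques*, Sém. Bourbaki 257 (1964), §5 Thm. 4 [Godement1964].
-/

set_option autoImplicit false

noncomputable section

open MeasureTheory Measure NumberField IsDedekindDomain Set Literature.MeasureTheory.Group
open scoped ENNReal NNReal

namespace Literature.NumberTheory.Automorphic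

namespace UnitaryGroup

variable {F E : Type} [Field F] [NumberField F] [Field E] [NumberField E] [Algebra F E] {c : E ≃ₐ[F] E}

/-! ## §1 The projection `d₀ : T(𝔸_F) →* 𝕀_E` -/

section Projection

/-- `d₀` as a homomorphism evaluates to the first diagonal idele (definitional). [cite: Rogawski1990, §1.10] -/
theorem diagUnitZeroHom_apply (t : (torusInBorel F E c 3)) : (MonoidHom.mk' (fun t : torusInBorel F E c 3 => diagUnit (t : borelAdelic F E c 3).2 0)
      (fun t t' => diagUnit_torus_mul t t' 0)) t = diagUnit (t : borelAdelic F E c 3).2 0 := rfl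

/-- **`d₀` is continuous** (★ `continuous_diagUnit_torus`). [cite: Rogawski1990, §1.10] -/
theorem continuous_diagUnitZeroHom : Continuous (MonoidHom.mk' (fun t : torusInBorel F E c 3 => diagUnit (t : borelAdelic F E c 3).2 0)
      (fun t t' => diagUnit_torus_mul t t' 0)) :=
  continuous_diagUnit_torus (F := F) (E := E) (c := c) 0

/-- **`d₀` is surjective**: `diag(a, 1, (c a)⁻¹) ↦ a` (★ `exists_torus_diagUnit_eq`). [cite: Rogawski1990, §1.10] -/
theorem diagUnitZeroHom_surjective (hc : c * c = 1) : Function.Surjective (MonoidHom.mk' (fun t : torusInBorel F E c 3 => diagUnit (t : borelAdelic F E c 3).2 0)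
      (fun t t' => diagUnit_torus_mul t t' 0)) := by
  intro a
  obtain ⟨t, -, h0, -⟩ := exists_torus_diagUnit_eq (F := F) hc a 1 (by rw [Units.val_one, map_one, one_mul])
  exact ⟨t, h0⟩

/-- `T(𝔸_F)` is locally compact, second countable and Hausdorff (closed subgroup of `B(𝔸_F)`, ★ `isTopSemidirect_borelAdelic`).
[cite: Rogawski1990, §1.10] -/
theorem locallyCompactSpace_secondCountable_t2_torusInBorel :
    LocallyCompactSpace (torusInBorel F E c 3) ∧ SecondCountableTopology (torusInBorel F E c 3) ∧ T2Space (torusInBorel F E c 3) := by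
  haveI := locallyCompactSpace_borelAdelic (F := F) (E := E) (c := c) (N := 3)
  haveI := secondCountableTopology_borelAdelic (F := F) (E := E) (c := c) (N := 3)
  haveI := t2Space_borelAdelic (F := F) (E := E) (c := c) (N := 3)
  exact ⟨(isTopSemidirect_borelAdelic (F := F) (E := E) (c := c) (N := 3)).isClosed_left.locallyCompactSpace,
    TopologicalSpace.Subtype.secondCountableTopology _, inferInstance⟩

/-- `𝕀_E` is locally compact, second countable and Hausdorff (tree letters ★ `t2Space_ideleGroup`,
★ `secondCountableTopology_ideleGroup`). [folklore-free restatement] [cite: Rogawski1990, §1.10] -/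
theorem locallyCompactSpace_secondCountable_t2_idele :
    LocallyCompactSpace (AdeleRing (𝓞 E) E)ˣ ∧ SecondCountableTopology (AdeleRing (𝓞 E) E)ˣ ∧ T2Space (AdeleRing (𝓞 E) E)ˣ := by
  haveI := locallyCompactSpace_adeleRing' E
  haveI := t2Space_ideleGroup E
  haveI : T2Space (AdeleRing (𝓞 E) E) := t2Space_adeleRing E
  exact ⟨inferInstance, secondCountableTopology_ideleGroup E, t2Space_ideleGroup E⟩

/-- **`d₀` is an open map** — the open mapping theorem for the continuous surjective homomorphism `d₀` of the σ-compact
`T(𝔸_F)` onto the locally compact `𝕀_E` (Mathlib `MonoidHom.isOpenMap_of_sigmaCompact`). [cite: Folland1995, §2.6] -/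
theorem isOpenMap_diagUnitZeroHom (hc : c * c = 1) : IsOpenMap (MonoidHom.mk' (fun t : torusInBorel F E c 3 => diagUnit (t : borelAdelic F E c 3).2 0)
      (fun t t' => diagUnit_torus_mul t t' 0)) := by
  obtain ⟨hT1, hT2, hT3⟩ := locallyCompactSpace_secondCountable_t2_torusInBorel (F := F) (E := E) (c := c)
  obtain ⟨hI1, hI2, hI3⟩ := locallyCompactSpace_secondCountable_t2_idele (E := E)
  exact MonoidHom.isOpenMap_of_sigmaCompact _ (diagUnitZeroHom_surjective hc) continuous_diagUnitZeroHom

/-- The first diagonal entry of a RATIONAL torus element is a principal idele. [cite: Rogawski1990, §1.10] -/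
theorem diagUnit_zero_mem_principalIdeles_of_mem (τ : ((rationalBorel F E c 3).subgroupOf (torusInBorel F E c 3))) :
    diagUnit (((τ : (torusInBorel F E c 3)) : borelAdelic F E c 3)).2 0 ∈ GaloisRepresentations.principalIdeles E := by
  -- the rational matrix behind `τ`
  obtain ⟨γ, hγ⟩ := (τ.2 : (((τ : (torusInBorel F E c 3)) : borelAdelic F E c 3) : (quasiSplit F E c 3).Adelic) ∈
    (quasiSplit F E c 3).arithmeticSubgroup)
  have hγ' : (((τ : (torusInBorel F E c 3)) : borelAdelic F E c 3) : (quasiSplit F E c 3).Adelic) = (quasiSplit F E c 3).toAdelic γ := hγ.symm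
  have hval : ((diagUnit (((τ : (torusInBorel F E c 3)) : borelAdelic F E c 3)).2 0 : (AdeleRing (𝓞 E) E)ˣ) : AdeleRing (𝓞 E) E) =
      algebraMap E (AdeleRing (𝓞 E) E) (((γ.val : GL (Fin 3) E) : Matrix (Fin 3) (Fin 3) E) 0 0) := by
    have h1 : ((diagUnit (((τ : (torusInBorel F E c 3)) : borelAdelic F E c 3)).2 0 : (AdeleRing (𝓞 E) E)ˣ) : AdeleRing (𝓞 E) E) =
        ((adelicVal F E c 3 _ (((τ : (torusInBorel F E c 3)) : borelAdelic F E c 3) : (quasiSplit F E c 3).Adelic) :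
          GL (Fin 3) (AdeleRing (𝓞 E) E)) : Matrix (Fin 3) (Fin 3) (AdeleRing (𝓞 E) E)) 0 0 := rfl
    rw [h1, hγ']
    rfl
  haveI : Nontrivial (AdeleRing (𝓞 E) E) := (AdeleRing.algebraMap_injective (𝓞 E) E).nontrivial
  have hne : (((γ.val : GL (Fin 3) E) : Matrix (Fin 3) (Fin 3) E) 0 0) ≠ 0 := by
    intro h0
    have h1 := (diagUnit (((τ : (torusInBorel F E c 3)) : borelAdelic F E c 3)).2 0).ne_zero
    rw [hval, h0, map_zero] at h1
    exact h1 rfl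
  refine ⟨Units.mk0 _ hne, Units.ext ?_⟩
  rw [hval]
  rfl

/-- **`d₀(Γ_T) = Eˣ`**: the rational torus maps ONTO the principal ideles (`⊆`: the entries of a rational matrix are rational;
`⊇`: `diag(k, 1, (c k)⁻¹) ∈ T(F)`, ★ `exists_rational_torus`). [cite: Rogawski1990, §1.10; §7.3 (p. 97)] -/
theorem map_rationalTorusInBorel_diagUnitZero_eq_principalIdeles (hc : c * c = 1) :
    ((rationalBorel F E c 3).subgroupOf (torusInBorel F E c 3)).map (MonoidHom.mk' (fun t : torusInBorel F E c 3 => diagUnit (t : borelAdelic F E c 3).2 0)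
      (fun t t' => diagUnit_torus_mul t t' 0)) = GaloisRepresentations.principalIdeles E := by
  ext x
  constructor
  · rintro ⟨τ, hτ, rfl⟩
    exact diagUnit_zero_mem_principalIdeles_of_mem ⟨τ, hτ⟩
  · rintro ⟨k, rfl⟩
    obtain ⟨τ, hτA, hτT, hτ0, -⟩ := exists_rational_torus (F := F) (c := c) (fun x => by rw [← AlgEquiv.mul_apply, hc, AlgEquiv.one_apply]) k 1
      (by rw [Units.val_one, map_one, one_mul])
    refine ⟨⟨τ, (mem_torusInBorel_iff_torusPart_eq τ).2 hτT⟩, hτA, ?_⟩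
    rw [diagUnitZeroHom_apply]
    exact hτ0

end Projection

/-! ## §2 The fibre `ker d₀ ≅ U(1)_{E/F}(𝔸_F)` has finite covolume modulo `Γ_T ⊓ ker d₀` -/

section Fibre

/-- **The rational torus `Γ_T` is discrete** (it embeds continuously in the discrete `G(F)`, ★ `isDiscreteRational_quasiSplit`).
[cite: Rogawski1990, §1.10] -/
theorem discreteTopology_rationalTorusInBorel : DiscreteTopology ((rationalBorel F E c 3).subgroupOf (torusInBorel F E c 3)) := by
  haveI : DiscreteTopology (quasiSplit F E c 3).arithmeticSubgroup := isDiscreteRational_quasiSplit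
  refine DiscreteTopology.of_continuous_injective
    (f := fun τ : ((rationalBorel F E c 3).subgroupOf (torusInBorel F E c 3)) => (⟨(((τ : (torusInBorel F E c 3)) : borelAdelic F E c 3) : (quasiSplit F E c 3).Adelic), τ.2⟩ :
      (quasiSplit F E c 3).arithmeticSubgroup)) ?_ ?_
  · exact Continuous.subtype_mk (continuous_subtype_val.comp (continuous_subtype_val.comp continuous_subtype_val)) _
  · intro τ τ' h
    have h' := congrArg (fun z : (quasiSplit F E c 3).arithmeticSubgroup => (z : (quasiSplit F E c 3).Adelic)) h
    exact Subtype.ext (Subtype.ext (Subtype.ext h'))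

/-- On the fibre `ker d₀` the coordinates are `d₀ = 1`, `d₂ = 1` and `d₁ ∈ U(1)(𝔸_F)` (★ `diagUnit_two_eq`,
★ `diagUnit_one_mem_adelicOne`). [cite: Rogawski1990, §1.10] -/
theorem diagUnit_of_mem_ker (s : (torusInBorel F E c 3)) (hs : s ∈ (MonoidHom.mk' (fun t : torusInBorel F E c 3 => diagUnit (t : borelAdelic F E c 3).2 0)
      (fun t t' => diagUnit_torus_mul t t' 0)).ker) :
    diagUnit (s : borelAdelic F E c 3).2 0 = 1 ∧ diagUnit (s : borelAdelic F E c 3).2 1 ∈ adelicOne F E c := by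
  have h0 : diagUnit (s : borelAdelic F E c 3).2 0 = 1 := (MonoidHom.mem_ker).1 hs
  exact ⟨h0, diagUnit_one_mem_adelicOne (torusPart_eq_self_of_mem s.2)⟩

/-- **Finite covolume from a set of representatives of finite measure** (generic reduction-theory step). Let `Γ, H ≤ G` be
subgroups of a second countable topological group with `Γ` discrete, `μS` a left-invariant measure on `H`, and `C ⊆ H` a
measurable set of finite measure met by every `(Γ ⊓ H)`-orbit (`∀ s, ∃ γ ∈ Γ ⊓ H, γ s ∈ C`). Then `H` carries a `(Γ ⊓ H)`-covering
weight of finite `μS`-integral: a covering weight exists (★ `exists_isCoveringWeight`, the lattice `Γ ⊓ H` is discrete) and any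
one satisfies `∫ wS dμS ≤ μS(C)` (★ `lintegral_mul_le_inv_mul_setLIntegral_of_le_coveringSum_indicator` with `F = 1`, `c₀ = 1`).
[cite: Raghunathan1972, Ch. I §1.4] [cite: Godement1964, §5] -/
theorem exists_isCoveringWeight_subgroupOf_of_measure_ne_top {G : Type*} [Group G] [TopologicalSpace G]
    [IsTopologicalGroup G] [SecondCountableTopology G] [MeasurableSpace G] [BorelSpace G] (Γ H : Subgroup G)
    [DiscreteTopology Γ] [Countable Γ] (μS : Measure H) [μS.IsMulLeftInvariant] {C : Set H} (hCm : MeasurableSet C)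
    (hCμ : μS C ≠ ∞) (hcov : ∀ s : H, ∃ γ : H, (γ : G) ∈ Γ ∧ γ * s ∈ C) :
    ∃ wS : H → ℝ≥0∞, IsCoveringWeight (Γ.subgroupOf H) wS ∧ ∫⁻ s, wS s ∂μS ≠ ∞ := by
  -- the lattice `Γ ⊓ H` of `H` is discrete and countable (it injects continuously into `Γ`)
  haveI : DiscreteTopology (Γ.subgroupOf H) :=
    DiscreteTopology.of_continuous_injective
      (f := fun σ : Γ.subgroupOf H => (⟨((σ : H) : G), Subgroup.mem_subgroupOf.1 σ.2⟩ : Γ))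
      (Continuous.subtype_mk (continuous_subtype_val.comp continuous_subtype_val) _)
      (fun σ σ' h => Subtype.ext (Subtype.ext (congrArg (fun z : Γ => (z : G)) h)))
  haveI : Countable (Γ.subgroupOf H) :=
    (show Function.Injective (fun σ : Γ.subgroupOf H => (⟨((σ : H) : G), Subgroup.mem_subgroupOf.1 σ.2⟩ : Γ)) from
      fun σ σ' h => Subtype.ext (Subtype.ext (congrArg (fun z : Γ => (z : G)) h))).countable
  obtain ⟨wS, hwS⟩ := exists_isCoveringWeight (Γ.subgroupOf H)
  haveI : MeasurableConstSMul (Γ.subgroupOf H) H := ⟨fun σ => measurable_const_mul ((σ : Γ.subgroupOf H) : H)⟩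
  haveI : SMulInvariantMeasure (Γ.subgroupOf H) H μS :=
    ⟨fun σ t _ht => by
      rw [show (fun x : H => σ • x) ⁻¹' t = (fun x : H => ((σ : Γ.subgroupOf H) : H) * x) ⁻¹' t from rfl,
        measure_preimage_mul]⟩
  -- every orbit meets `C`
  have hmeet : ∀ s : H, 1 ≤ coveringSum (Γ.subgroupOf H) (C.indicator 1) s := by
    intro s
    obtain ⟨γ, hγ, hγs⟩ := hcov s
    rw [coveringSum_apply]
    calc (1 : ℝ≥0∞) = C.indicator 1 (γ * s) := by rw [Set.indicator_of_mem hγs, Pi.one_apply]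
      _ = C.indicator (1 : H → ℝ≥0∞) ((⟨γ, Subgroup.mem_subgroupOf.2 hγ⟩ : Γ.subgroupOf H) • s) := rfl
      _ ≤ ∑' σ : Γ.subgroupOf H, C.indicator (1 : H → ℝ≥0∞) (σ • s) :=
        ENNReal.le_tsum (⟨γ, Subgroup.mem_subgroupOf.2 hγ⟩ : Γ.subgroupOf H)
  -- domination: `∫ wS ≤ μS(C) < ∞`
  have hle := lintegral_mul_le_inv_mul_setLIntegral_of_le_coveringSum_indicator μS (F := fun _ => (1 : ℝ≥0∞))
    measurable_const (fun _ _ => rfl) hwS.measurable (fun s => (hwS.coveringSum_eq s).le) hCm one_ne_zero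
    ENNReal.one_ne_top hmeet
  refine ⟨wS, hwS, ne_top_of_le_ne_top ?_ (le_trans (le_of_eq ?_) hle)⟩
  · rw [inv_one, one_mul, setLIntegral_const, one_mul]
    exact hCμ
  · simp only [one_mul]

/-- **Godement's compact set of representatives on the fibre.** For `[E : F] = 2`, `c² = 1`, `c ≠ 1` there is a compact
`KT ⊆ {t ∈ T(𝔸_F) : d₀ t = 1}` such that every `s` with `d₀ s = 1` is moved into `KT` by a RATIONAL torus element `τ ∈ Γ_T` with
`d₀ τ = 1`: `U(1)(𝔸_F) = W₁ · E¹` with `W₁` compact (★ `exists_isCompact_adelicOne_cover`), `KT = {d₀ = 1, d₁ ∈ W₁}` is compact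
(★ `isCompact_setOf_diagUnit_mem`), and `τ = diag(1, q, 1)` (★ `exists_rational_torus`). [cite: Godement1964, §5 Thm. 4]
[cite: Rogawski1990, §7.3 (p. 97)] -/
theorem exists_isCompact_forall_exists_rationalTorus_mul_mem (h2 : Module.finrank F E = 2) (hc : c * c = 1) (hc1 : c ≠ 1) :
    ∃ KT : Set (torusInBorel F E c 3), IsCompact KT ∧ KT ⊆ {t | diagUnit (t : borelAdelic F E c 3).2 0 = 1} ∧
      ∀ s : (torusInBorel F E c 3), diagUnit (s : borelAdelic F E c 3).2 0 = 1 →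
        ∃ τ : (torusInBorel F E c 3), τ ∈ ((rationalBorel F E c 3).subgroupOf (torusInBorel F E c 3)) ∧ diagUnit (τ : borelAdelic F E c 3).2 0 = 1 ∧ τ * s ∈ KT := by
  -- Godement's compact cover of `U(1)(𝔸_F)` and the compact coordinate set `KT`
  obtain ⟨W₁, hW₁c, -, hcov⟩ := exists_isCompact_adelicOne_cover F E c h2 hc1
  refine ⟨{t | diagUnit (t : borelAdelic F E c 3).2 0 ∈ ({1} : Set (AdeleRing (𝓞 E) E)ˣ) ∧ diagUnit (t : borelAdelic F E c 3).2 1 ∈ W₁},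
    isCompact_setOf_diagUnit_mem hc isCompact_singleton hW₁c, fun t ht => Set.mem_singleton_iff.1 ht.1, fun s hs0 => ?_⟩
  have hs1 : diagUnit (s : borelAdelic F E c 3).2 1 ∈ adelicOne F E c :=
    diagUnit_one_mem_adelicOne (torusPart_eq_self_of_mem s.2)
  obtain ⟨q, hqA, hqW⟩ := hcov _ hs1
  have hq : c (q : E) * q = 1 := by
    have h := (mem_adelicOne_iff F E c _).1 hqA
    rw [principalIdele_eq_unitsMap] at h
    change conjAdele F E c (algebraMap E (AdeleRing (𝓞 E) E) (q : E)) * algebraMap E (AdeleRing (𝓞 E) E) (q : E) = 1 at h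
    rw [← algebraMap_conj, ← map_mul] at h
    exact (AdeleRing.algebraMap_injective (𝓞 E) E) (by rw [map_one]; simpa using h)
  -- the rational torus element `diag(1, q, 1)`
  obtain ⟨τ, hτA, hτT, hτ0, hτ1⟩ := exists_rational_torus (F := F) (c := c) (fun x => by rw [← AlgEquiv.mul_apply, hc, AlgEquiv.one_apply]) 1 q hq
  have hτT' : τ ∈ (torusInBorel F E c 3) := (mem_torusInBorel_iff_torusPart_eq τ).2 hτT
  have hτ0' : diagUnit (((⟨τ, hτT'⟩ : (torusInBorel F E c 3)) : borelAdelic F E c 3)).2 0 = 1 := by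
    change diagUnit τ.2 0 = 1
    rw [hτ0, map_one]
  refine ⟨⟨τ, hτT'⟩, Subgroup.mem_subgroupOf.2 (Subgroup.mem_comap.2 hτA), hτ0', ?_, ?_⟩
  · rw [Set.mem_singleton_iff, diagUnit_torus_mul, hs0, mul_one]
    exact hτ0'
  · rw [diagUnit_torus_mul]
    change diagUnit τ.2 1 * diagUnit ((s : (torusInBorel F E c 3)) : borelAdelic F E c 3).2 1 ∈ W₁
    rw [hτ1, mul_comm]
    exact hqW

variable [MeasurableSpace (quasiSplit F E c 3).Adelic] [BorelSpace (quasiSplit F E c 3).Adelic]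

/-- **THE FIBRE HAS FINITE COVOLUME** (form for any homomorphism `α` agreeing with `d₀` pointwise): for `[E : F] = 2`, `c² = 1`,
`c ≠ 1` and every Haar measure `μS` on `ker α ≤ T(𝔸_F)` there is a `(Γ_T ⊓ ker α)`-covering weight `wS` on `ker α` with
`∫ wS dμS < ∞`: the compact `K = KT ∩ ker α` of `exists_isCompact_forall_exists_rationalTorus_mul_mem` meets every orbit, and
`exists_isCoveringWeight_subgroupOf_of_measure_ne_top` applies (the rational torus is discrete, `discreteTopology_rationalTorusInBorel`).
[cite: Godement1964, §5 Thm. 4] [cite: Rogawski1990, §7.3 (p. 97)] -/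
theorem exists_isCoveringWeight_ker_of_eq_diagUnitZero (h2 : Module.finrank F E = 2) (hc : c * c = 1) (hc1 : c ≠ 1)
    (α : (torusInBorel F E c 3) →* (AdeleRing (𝓞 E) E)ˣ) (hα : ∀ t, α t = diagUnit (t : borelAdelic F E c 3).2 0) (μS : Measure α.ker) [IsHaarMeasure μS] :
    ∃ wS : α.ker → ℝ≥0∞, IsCoveringWeight (((rationalBorel F E c 3).subgroupOf (torusInBorel F E c 3)).subgroupOf α.ker) wS ∧ ∫⁻ s, wS s ∂μS ≠ ∞ := by
  obtain ⟨hT1, hT2, hT3⟩ := locallyCompactSpace_secondCountable_t2_torusInBorel (F := F) (E := E) (c := c)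
  haveI := discreteTopology_rationalTorusInBorel (F := F) (E := E) (c := c)
  haveI := countable_rationalTorusInBorel (F := F) (E := E) (c := c) (N := 3)
  obtain ⟨KT, hKTc, hKT0, hcov⟩ := exists_isCompact_forall_exists_rationalTorus_mul_mem (F := F) (E := E) (c := c) h2 hc hc1
  -- `KT ⊆ ker α`, so its preimage `K` in the fibre is compact
  have hKTker : ∀ t ∈ KT, t ∈ α.ker := fun t ht => by
    rw [MonoidHom.mem_ker, hα]
    exact hKT0 ht
  have hKc : IsCompact (Subtype.val ⁻¹' KT : Set α.ker) := by
    rw [Subtype.isCompact_iff, Set.image_preimage_eq_of_subset (fun t ht => ⟨⟨t, hKTker t ht⟩, rfl⟩)]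
    exact hKTc
  refine exists_isCoveringWeight_subgroupOf_of_measure_ne_top ((rationalBorel F E c 3).subgroupOf (torusInBorel F E c 3)) α.ker μS hKc.isClosed.measurableSet
    hKc.measure_lt_top.ne fun s => ?_
  -- every orbit meets `K`: translate by the rational `diag(1, q, 1)`
  have hs0 : diagUnit ((s : (torusInBorel F E c 3)) : borelAdelic F E c 3).2 0 = 1 := by
    rw [← hα]
    exact (MonoidHom.mem_ker).1 s.2
  obtain ⟨τ, hτΓ, hτ0, hτs⟩ := hcov (s : (torusInBorel F E c 3)) hs0
  have hτker : τ ∈ α.ker := by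
    rw [MonoidHom.mem_ker, hα]
    exact hτ0
  exact ⟨⟨τ, hτker⟩, hτΓ, hτs⟩

/-- **THE FIBRE OF `d₀` HAS FINITE COVOLUME**: for `[E : F] = 2`, `c² = 1`, `c ≠ 1` and every Haar measure `μS` on
`ker d₀ ≤ T(𝔸_F)` there is a `(Γ_T ⊓ ker d₀)`-covering weight `wS` on `ker d₀` with `∫ wS dμS < ∞` (`ker d₀ ≅ U(1)_{E/F}(𝔸_F)` and
`E¹∖U(1)(𝔸_F)` is compact — Godement; `exists_isCoveringWeight_ker_of_eq_diagUnitZero` at `α = d₀`).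
[cite: Godement1964, §5 Thm. 4] [cite: Rogawski1990, §7.3 (p. 97)] -/
theorem exists_isCoveringWeight_ker_diagUnitZero (h2 : Module.finrank F E = 2) (hc : c * c = 1) (hc1 : c ≠ 1)
    (μS : Measure (MonoidHom.mk' (fun t : torusInBorel F E c 3 => diagUnit (t : borelAdelic F E c 3).2 0)
      (fun t t' => diagUnit_torus_mul t t' 0)).ker) [IsHaarMeasure μS] :
    ∃ wS : (MonoidHom.mk' (fun t : torusInBorel F E c 3 => diagUnit (t : borelAdelic F E c 3).2 0)
      (fun t t' => diagUnit_torus_mul t t' 0)).ker → ℝ≥0∞,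
      IsCoveringWeight (((rationalBorel F E c 3).subgroupOf (torusInBorel F E c 3)).subgroupOf (MonoidHom.mk' (fun t : torusInBorel F E c 3 => diagUnit (t : borelAdelic F E c 3).2 0)
      (fun t t' => diagUnit_torus_mul t t' 0)).ker) wS ∧ ∫⁻ s, wS s ∂μS ≠ ∞ :=
  exists_isCoveringWeight_ker_of_eq_diagUnitZero h2 hc hc1 (MonoidHom.mk' (fun t : torusInBorel F E c 3 => diagUnit (t : borelAdelic F E c 3).2 0)
      (fun t t' => diagUnit_torus_mul t t' 0)) (fun _ => rfl) μS

end Fibre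

/-! ## §3 The row: `∫_{T(F)∖T(𝔸_F)} G(d₀ t) dt = C · ∫_{Eˣ∖𝕀_E} G` -/

section Row

variable [MeasurableSpace (quasiSplit F E c 3).Adelic] [BorelSpace (quasiSplit F E c 3).Adelic]
  [MeasurableSpace (AdeleRing (𝓞 E) E)ˣ] [BorelSpace (AdeleRing (𝓞 E) E)ˣ]

/-- **TORUS-TO-IDELE UNFOLDING ALONG `d₀`.** For a quadratic `E/F` (`[E : F] = 2`) with involution `c` (`c² = 1`, `c ≠ 1`), Haar
measures `μT` on `T(𝔸_F) = torusInBorel F E c 3` and `μE` on `𝕀_E`: there is `C ∈ (0, ∞)` such that for every covering weight `w`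
of the rational torus `Γ_T`, every covering weight `wE` of the principal ideles and every Borel `Eˣ`-invariant `G : 𝕀_E → [0, ∞]`,
`∫⁻ G(d₀ t) w(t) dμT = C · ∫⁻ G(x) wE(x) dμE` — i.e. `∫_{T(F)∖T(𝔸_F)} G ∘ d₀ = C ∫_{Eˣ∖𝕀_E} G` (★ `CoveringWeightsPushforward` at
`α = d₀`: abelian ★ `torusInBorel_comm`, open §1, `Λ = Eˣ` §1, finite fibre covolume §2).
[cite: Rogawski1990, §7.2 (p. 94); §7.3 (p. 97)] [cite: Folland1995, §2.6 Thm. 2.49] -/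
theorem exists_lintegral_comp_diagUnitZero_mul_weight_eq (h2 : Module.finrank F E = 2) (hc : c * c = 1) (hc1 : c ≠ 1)
    (μT : Measure (torusInBorel F E c 3)) [IsHaarMeasure μT] (μE : Measure (AdeleRing (𝓞 E) E)ˣ) [IsHaarMeasure μE] :
    ∃ C : ℝ≥0∞, C ≠ 0 ∧ C ≠ ∞ ∧ ∀ w : (torusInBorel F E c 3) → ℝ≥0∞, IsCoveringWeight ((rationalBorel F E c 3).subgroupOf (torusInBorel F E c 3)) w →
      ∀ wE : (AdeleRing (𝓞 E) E)ˣ → ℝ≥0∞, IsCoveringWeight (GaloisRepresentations.principalIdeles E) wE →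
      ∀ G : (AdeleRing (𝓞 E) E)ˣ → ℝ≥0∞, Measurable G → (∀ k ∈ GaloisRepresentations.principalIdeles E, ∀ x, G (k * x) = G x) →
        ∫⁻ t, G (diagUnit (t : borelAdelic F E c 3).2 0) * w t ∂μT = C * ∫⁻ x, G x * wE x ∂μE := by
  obtain ⟨hT1, hT2, hT3⟩ := locallyCompactSpace_secondCountable_t2_torusInBorel (F := F) (E := E) (c := c)
  obtain ⟨hI1, hI2, hI3⟩ := locallyCompactSpace_secondCountable_t2_idele (E := E)
  haveI := discreteTopology_rationalTorusInBorel (F := F) (E := E) (c := c)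
  haveI := countable_rationalTorusInBorel (F := F) (E := E) (c := c) (N := 3)
  haveI : IsClosed (((MonoidHom.mk' (fun t : torusInBorel F E c 3 => diagUnit (t : borelAdelic F E c 3).2 0)
      (fun t t' => diagUnit_torus_mul t t' 0)).ker : Subgroup (torusInBorel F E c 3)) : Set (torusInBorel F E c 3)) := by
    haveI := t2Space_ideleGroup E
    rw [MonoidHom.coe_ker]
    exact isClosed_singleton.preimage continuous_diagUnitZeroHom
  letI : CommGroup (torusInBorel F E c 3) := { (inferInstance : Group (torusInBorel F E c 3)) with mul_comm := torusInBorel_comm }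
  -- a Haar measure on the fibre and its finite-covolume witness
  obtain ⟨wS, hwS, hfin⟩ := exists_isCoveringWeight_ker_diagUnitZero h2 hc hc1 (Measure.haar : Measure (MonoidHom.mk' (fun t : torusInBorel F E c 3 => diagUnit (t : borelAdelic F E c 3).2 0)
      (fun t t' => diagUnit_torus_mul t t' 0)).ker)
  obtain ⟨C, hC0, hCt, hC⟩ := exists_lintegral_comp_mul_weight_eq_mul_lintegral (MonoidHom.mk' (fun t : torusInBorel F E c 3 => diagUnit (t : borelAdelic F E c 3).2 0)
      (fun t t' => diagUnit_torus_mul t t' 0)) ((rationalBorel F E c 3).subgroupOf (torusInBorel F E c 3)) continuous_diagUnitZeroHom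
    (isOpenMap_diagUnitZeroHom hc) (diagUnitZeroHom_surjective hc) μT μE (Measure.haar : Measure (MonoidHom.mk' (fun t : torusInBorel F E c 3 => diagUnit (t : borelAdelic F E c 3).2 0)
      (fun t t' => diagUnit_torus_mul t t' 0)).ker) hwS hfin
  refine ⟨C, hC0, hCt, fun w hw wE hwE G hG hGinv => ?_⟩
  have hmap := map_rationalTorusInBorel_diagUnitZero_eq_principalIdeles (F := F) (E := E) (c := c) hc
  have hwE' : IsCoveringWeight (((rationalBorel F E c 3).subgroupOf (torusInBorel F E c 3)).map (MonoidHom.mk' (fun t : torusInBorel F E c 3 => diagUnit (t : borelAdelic F E c 3).2 0)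
      (fun t t' => diagUnit_torus_mul t t' 0))) wE := by rw [hmap]; exact hwE
  have hGinv' : ∀ l ∈ ((rationalBorel F E c 3).subgroupOf (torusInBorel F E c 3)).map (MonoidHom.mk' (fun t : torusInBorel F E c 3 => diagUnit (t : borelAdelic F E c 3).2 0)
      (fun t t' => diagUnit_torus_mul t t' 0)), ∀ x : (AdeleRing (𝓞 E) E)ˣ, G (l * x) = G x := by rw [hmap]; exact hGinv
  exact hC w hw wE hwE' G hG hGinv'

/-- **The same against an idele class domain** `𝓕 ⊆ 𝕀_E` (`IsIdeleClassDomain E 𝓕`, ★ `IdeleClassIntegration`):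
`∫⁻ G(d₀ t) w(t) dμT = C · ∫⁻_{𝓕} G dμE` for every `Γ_T`-covering weight `w` and Borel `Eˣ`-invariant `G ≥ 0` — the shape
`m(…) ∫_{E^*∖I_E}` of [Rogawski1990, p. 97] in the tree's `𝓕`-currency. [cite: Rogawski1990, §7.3 (p. 97)] [cite: Folland1995, §2.6 Thm. 2.49] -/
theorem exists_lintegral_comp_diagUnitZero_mul_weight_eq_setLIntegral (h2 : Module.finrank F E = 2) (hc : c * c = 1)
    (hc1 : c ≠ 1) (μT : Measure (torusInBorel F E c 3)) [IsHaarMeasure μT] (μE : Measure (AdeleRing (𝓞 E) E)ˣ) [IsHaarMeasure μE] :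
    ∃ C : ℝ≥0∞, C ≠ 0 ∧ C ≠ ∞ ∧ ∀ w : (torusInBorel F E c 3) → ℝ≥0∞, IsCoveringWeight ((rationalBorel F E c 3).subgroupOf (torusInBorel F E c 3)) w →
      ∀ 𝓕 : Set (AdeleRing (𝓞 E) E)ˣ, IsIdeleClassDomain E 𝓕 →
      ∀ G : (AdeleRing (𝓞 E) E)ˣ → ℝ≥0∞, Measurable G → (∀ k ∈ GaloisRepresentations.principalIdeles E, ∀ x, G (k * x) = G x) →
        ∫⁻ t, G (diagUnit (t : borelAdelic F E c 3).2 0) * w t ∂μT = C * ∫⁻ x in 𝓕, G x ∂μE := by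
  obtain ⟨hT1, hT2, hT3⟩ := locallyCompactSpace_secondCountable_t2_torusInBorel (F := F) (E := E) (c := c)
  obtain ⟨hI1, hI2, hI3⟩ := locallyCompactSpace_secondCountable_t2_idele (E := E)
  haveI := discreteTopology_rationalTorusInBorel (F := F) (E := E) (c := c)
  haveI := countable_rationalTorusInBorel (F := F) (E := E) (c := c) (N := 3)
  haveI : IsClosed (((MonoidHom.mk' (fun t : torusInBorel F E c 3 => diagUnit (t : borelAdelic F E c 3).2 0)
      (fun t t' => diagUnit_torus_mul t t' 0)).ker : Subgroup (torusInBorel F E c 3)) : Set (torusInBorel F E c 3)) := by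
    haveI := t2Space_ideleGroup E
    rw [MonoidHom.coe_ker]
    exact isClosed_singleton.preimage continuous_diagUnitZeroHom
  letI : CommGroup (torusInBorel F E c 3) := { (inferInstance : Group (torusInBorel F E c 3)) with mul_comm := torusInBorel_comm }
  obtain ⟨wS, hwS, hfin⟩ := exists_isCoveringWeight_ker_diagUnitZero h2 hc hc1 (Measure.haar : Measure (MonoidHom.mk' (fun t : torusInBorel F E c 3 => diagUnit (t : borelAdelic F E c 3).2 0)
      (fun t t' => diagUnit_torus_mul t t' 0)).ker)
  obtain ⟨C, hC0, hCt, hC⟩ := exists_lintegral_comp_mul_weight_eq_mul_setLIntegral (MonoidHom.mk' (fun t : torusInBorel F E c 3 => diagUnit (t : borelAdelic F E c 3).2 0)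
      (fun t t' => diagUnit_torus_mul t t' 0)) ((rationalBorel F E c 3).subgroupOf (torusInBorel F E c 3)) continuous_diagUnitZeroHom
    (isOpenMap_diagUnitZeroHom hc) (diagUnitZeroHom_surjective hc) μT μE (Measure.haar : Measure (MonoidHom.mk' (fun t : torusInBorel F E c 3 => diagUnit (t : borelAdelic F E c 3).2 0)
      (fun t t' => diagUnit_torus_mul t t' 0)).ker) hwS hfin
  refine ⟨C, hC0, hCt, fun w hw 𝓕 h𝓕 G hG hGinv => ?_⟩
  have hmap := map_rationalTorusInBorel_diagUnitZero_eq_principalIdeles (F := F) (E := E) (c := c) hc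
  have huniq : ∀ x : (AdeleRing (𝓞 E) E)ˣ,
      ∃! l : ((rationalBorel F E c 3).subgroupOf (torusInBorel F E c 3)).map (MonoidHom.mk' (fun t : torusInBorel F E c 3 => diagUnit (t : borelAdelic F E c 3).2 0)
      (fun t t' => diagUnit_torus_mul t t' 0)), l • x ∈ 𝓕 := by rw [hmap]; exact h𝓕.existsUnique
  have hGinv' : ∀ l ∈ ((rationalBorel F E c 3).subgroupOf (torusInBorel F E c 3)).map (MonoidHom.mk' (fun t : torusInBorel F E c 3 => diagUnit (t : borelAdelic F E c 3).2 0)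
      (fun t t' => diagUnit_torus_mul t t' 0)), ∀ x : (AdeleRing (𝓞 E) E)ˣ, G (l * x) = G x := by rw [hmap]; exact hGinv
  exact hC w hw 𝓕 h𝓕.measurableSet huniq G hG hGinv'

end Row

end UnitaryGroup

end Literature.NumberTheory.Automorphic
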